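/-
Copyright: public-audit package `pub-balaban` (b2b-balaban), seat pv28-g13. Released under Apache 2.0 like Mathlib.
-/
import Literature.MathematicalPhysics.QuantumFieldTheory.Balaban1983to89.T4GnomonicWilsonHessian

/-!
# T4 — caveat (PLAQ) of `T4GnomonicWilsonHessian`: the Wilson action IS one-link quaternion-affine through every
# bond of every torus of the cell — the `LinkAffine` instance, with its explicit staple datum

* Value = kernel certificate (finite algebra/combinatorics on the cell's tori); NOT summit progress; NOT continuum; NOT
  Clay.  0 [cite], 0 [model]: everything here is [folklore]; NO printed sentence is asserted and nothing internally
  minted is cited (ABSOLUTE RULE).  Cell row T4-O3.E-iii-b-G7 (BL-window), lineage pv28, record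
  `t4/T4-EST-O3Eiiib-G7.md` §2decies; this leaf discharges the located residual (PLAQ) of GAPS G-pv28g13-1.
* WHAT IT DISCHARGES.  `T4GnomonicWilsonHessian.mem_respDom_of_gnoChart_linkAffine(′)` asks for
  `LinkAffine h uᵢ b κᵢ aᵢ : ∀ g, h(uᵢ with uᵢ(b) := g) = κᵢ + Re(su2Quat g · aᵢ)` and constructs NO instance.  Here the
  instance is constructed for every multiple `U ↦ c · wilsonAction w U` of the cell's Wilson action
  (`Setup.wilsonAction w U = Σ_p w (1 − reTr U(∂p))`), at EVERY base field `u`, through EVERY bond `b`, on EVERY torus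
  `T^{(j)}` of the cell — unconditionally (`linkAffine_wilsonAction`), with the datum in closed form
  (`wilsonDatum c w u b = Σ_p (−c·w) · plaqDatum u b p`, the per-plaquette STAPLE quaternions `plaqDatum`).
* WHY IT IS UNCONDITIONAL.  The parent's docstring feared "when the four bonds of each `∂p ∋ b` are distinct".  They
  always are: `Params.sitesPerDir j = 2·L^{m+K−j} ≥ 2`, so `1 ≠ 0` in `ZMod (sitesPerDir j)` and `x + e_ν ≠ x` on every
  torus of the cell (`shift_ne_self`); with `μ < ν` the four letters `⟨x,μ⟩, ⟨x+e_μ,ν⟩, ⟨x+e_ν,μ⟩, ⟨x,ν⟩` of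
  `GaugeField.plaqHol U p` are pairwise distinct (`letters_pairwise_ne`).  Hence, as a function of one link
  `g = U(b)` with the other links frozen at `u`, every plaquette term `reTr U(∂p)` is either constant (`b ∉ ∂p`) or ONE
  conjugated letter `reTr(L·g·R)` (positions 1, 2) or `reTr(L·g⁻¹·R)` (positions 3, 4), i.e. `Re(su2Quat g · a)` with
  `a = su2Quat R · su2Quat L`, resp. `a = star(su2Quat R · su2Quat L)` (`reTr_conj_link`, `su2Quat_inv`, `re_star_mul`):
  `linkAffine_reTr_plaqHol`.
* READING at the trivial configuration (§5, typed): `plaqDatum 1 b p = 1` if `b ∈ ∂p` and `0` otherwise, so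
  `wilsonDatum c w 1 b = (−c·w·N_b : ℝ)` with `N_b = #{p : b ∈ ∂p}` (`wilsonDatum_one`) — an ALIGNED datum (`B = 0`,
  `A = −c·w·N_b`, positive for the exponent `h = −β·A_W`, `c = −β < 0`, `w > 0`, `d ≥ 2`), and the count is a theorem:
  `N_b = 2(d − 1)` on every torus of the cell (`letterCount_eq`), so `A = 2(d−1)βw` at `u₀ = 1` (`wilsonDatum_one_re`)
  — the parent's informal READING "A = 2(d−1)β" made a decl (for `w = 1`).

## Content

* §1 closure of `LinkAffine` under the affine operations (`linkAffine_const`, `linkAffine_add/smul/neg/sum`,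
  `linkAffine_add_indep` for a `U(b)`-independent rest, `linkAffine_congr`).
* §2 quaternion bookkeeping: `su2Quat_inv` (`= star`), `re_star_mul`.
* §3 the letters of a plaquette: `shift_ne_self`, `bond₁…bond₄`, `letters_pairwise_ne`, `IsLetter`,
  `plaqHol_eq_letters`; the staple datum `plaqDatum`, `plaqKappa`; **`linkAffine_reTr_plaqHol`**.
* §4 **`linkAffine_wilsonAction`** (`wilsonKappa`, `wilsonDatum`), and the corollary for an added `U(b)`-independent
  term (`linkAffine_wilsonAction_add_indep`).
* §5 the trivial configuration: `plaqDatum_one`, `letterCount`, `wilsonDatum_one`, `wilsonDatum_one_aligned`;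
  §5b the count `letterCount_eq : N_b = 2(d − 1)` (four position counts `card_filter_bondᵢ` = `#Ioi μ`, `#Iio μ`,
  mutually exclusive by `letters_pairwise_ne`) and `wilsonDatum_one_re : A = −2(d−1)·c·w` at `u₀ = 1`.

## Honest caveats

* (N1)/(ALIGN)/(RANK)/(INS) of the parent are untouched: one-link fibres only; the NUMBERS `Re(aᵢ·q₀) ≥ 0`, `b₀`, `ρ`,
  `μ`, `0 < gnoKappa S' + μ` that the parent's plug consumes are still to be produced Bałaban-side from a small-field
  condition on `u₀`, `u` (this leaf only identifies the datum `a` as the staple sum and computes it at `u₀ = 1`);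
  `SU(2)` only.  In particular NOTHING here bounds the transverse part `‖a‖² − Re(a·q₀)²` or aligns `Re(aᵢ·q₀) ≥ 0`
  away from `u₀ = 1`.
* Bałaban's effective actions after `k ≥ 1` steps are NOT of Wilson form; this instance is the `k = 0` (pure Wilson)
  exponent only.
-/

noncomputable section

open scoped Quaternion

namespace Literature.MathematicalPhysics.QuantumFieldTheory.Balaban1983to89.T4WilsonLinkAffine

open Literature.MathematicalPhysics.QuantumLattice (su2Quat norm_su2Quat)
open T4HaarSU2Translate (su2Quat_mul su2Quat_one)
open T4CubeChartGnomonic (SU2)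
open T4GnomonicWilsonHessian (LinkAffine reTr_eq_re_su2Quat reTr_conj_link)

variable {P : Params} {j : ℕ}

/-! ## §1  Closure of `LinkAffine` under affine operations -/

section Closure

variable [DecidableEq (PBond P j)] {u : GaugeField P j SU2} {b : PBond P j}

/-- A constant exponent is link-affine with datum `(c, 0)`. [folklore] -/
theorem linkAffine_const (c : ℝ) : LinkAffine (fun _ => c) u b c 0 := by
  intro g
  simp

/-- Two data for the same exponent agree pointwise in `g`; in particular `LinkAffine` transports along equal
functions. [folklore] -/
theorem linkAffine_congr {h h' : Density P j SU2} {κ : ℝ} {a : ℍ} (H : LinkAffine h u b κ a)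
    (hh : ∀ U, h' U = h U) : LinkAffine h' u b κ a := fun g => by rw [hh, H g]

/-- Sum of two link-affine exponents. [folklore] -/
theorem linkAffine_add {h₁ h₂ : Density P j SU2} {κ₁ κ₂ : ℝ} {a₁ a₂ : ℍ} (H₁ : LinkAffine h₁ u b κ₁ a₁)
    (H₂ : LinkAffine h₂ u b κ₂ a₂) : LinkAffine (fun U => h₁ U + h₂ U) u b (κ₁ + κ₂) (a₁ + a₂) := by
  intro g
  dsimp only
  rw [H₁ g, H₂ g, mul_add, Quaternion.re_add]
  ring

/-- Real multiple of a link-affine exponent. [folklore] -/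
theorem linkAffine_smul {h : Density P j SU2} {κ : ℝ} {a : ℍ} (H : LinkAffine h u b κ a) (c : ℝ) :
    LinkAffine (fun U => c * h U) u b (c * κ) (c • a) := by
  intro g
  dsimp only
  rw [H g, mul_smul_comm, Quaternion.re_smul, smul_eq_mul]
  ring

/-- Negative of a link-affine exponent. [folklore] -/
theorem linkAffine_neg {h : Density P j SU2} {κ : ℝ} {a : ℍ} (H : LinkAffine h u b κ a) :
    LinkAffine (fun U => -h U) u b (-κ) (-a) := by
  intro g
  dsimp only
  rw [H g, mul_neg, Quaternion.re_neg]
  ring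

/-- Adding a term that does not depend on the link `U(b)` only shifts the constant. [folklore] -/
theorem linkAffine_add_indep {h r : Density P j SU2} {κ : ℝ} {a : ℍ} (H : LinkAffine h u b κ a)
    (hr : ∀ g : SU2, r (Function.update u b g) = r u) :
    LinkAffine (fun U => h U + r U) u b (κ + r u) a := by
  intro g
  dsimp only
  rw [H g, hr g]
  ring

/-- Finite sums of link-affine exponents. [folklore] -/
theorem linkAffine_sum {ι : Type*} (s : Finset ι) {H : ι → Density P j SU2} {κ : ι → ℝ} {a : ι → ℍ}
    (hH : ∀ i ∈ s, LinkAffine (H i) u b (κ i) (a i)) :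
    LinkAffine (fun U => ∑ i ∈ s, H i U) u b (∑ i ∈ s, κ i) (∑ i ∈ s, a i) := by
  classical
  induction s using Finset.induction_on with
  | empty => intro g; simp
  | insert i s hi ih =>
    have h1 : LinkAffine (H i) u b (κ i) (a i) := hH i (Finset.mem_insert_self i s)
    have h2 := ih fun k hk => hH k (Finset.mem_insert_of_mem hk)
    intro g
    have h2g := h2 g
    dsimp only at h2g ⊢
    rw [Finset.sum_insert hi, Finset.sum_insert hi, Finset.sum_insert hi, h1 g, h2g, mul_add,
      Quaternion.re_add]
    ring

end Closure

/-! ## §2  Quaternion bookkeeping: inverse letters -/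

/-- On `SU(2)` the quaternion of the inverse is the conjugate quaternion. [folklore] -/
theorem su2Quat_inv (U : SU2) : su2Quat U⁻¹ = star (su2Quat U) := by
  have h1 : su2Quat U⁻¹ * su2Quat U = 1 := by rw [← su2Quat_mul, inv_mul_cancel, su2Quat_one]
  have hn : Quaternion.normSq (su2Quat U) = 1 := by
    rw [Quaternion.normSq_eq_norm_mul_self, norm_su2Quat, mul_one]
  have h2 : star (su2Quat U) * su2Quat U = 1 := by
    rw [Quaternion.star_mul_self, hn, Quaternion.coe_one]
  have hU : su2Quat U ≠ 0 := Literature.MathematicalPhysics.QuantumLattice.su2Quat_ne_zero U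
  exact mul_right_cancel₀ hU (h1.trans h2.symm)

/-- `Re(q̄ · m) = Re(q · m̄)`. [folklore] -/
theorem re_star_mul (q m : ℍ) : (star q * m).re = (q * star m).re := by
  simp only [Quaternion.re_mul, Quaternion.re_star, Quaternion.imI_star, Quaternion.imJ_star,
    Quaternion.imK_star]
  ring

/-! ## §3  The four letters of a plaquette are pairwise distinct; the staple datum -/

/-- Every torus of the cell has at least two sites per direction (`sitesPerDir j = 2·L^{m+K−j}`), so `ZMod` of it is
nontrivial. [folklore] -/
theorem nontrivial_zmod_sitesPerDir (P : Params) (j : ℕ) : Nontrivial (ZMod (P.sitesPerDir j)) :=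
  ZMod.nontrivial_iff.2 (by unfold Params.sitesPerDir; omega)

/-- `x + e_μ ≠ x` on every torus of the cell. [folklore] -/
theorem shift_ne_self (x : Site P j) (μ : Fin P.d) : x.shift μ ≠ x := by
  haveI := nontrivial_zmod_sitesPerDir P j
  intro h
  have h1 := congr_fun h μ
  simp only [Site.shift, Function.update_self] at h1
  exact one_ne_zero (add_eq_left.1 h1)

/-- Letter 1 of `∂p`: `⟨x, μ⟩`. [folklore] -/
def bond₁ (p : Plaq P j) : PBond P j := ⟨p.src, p.μ⟩
/-- Letter 2 of `∂p`: `⟨x + e_μ, ν⟩`. [folklore] -/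
def bond₂ (p : Plaq P j) : PBond P j := ⟨p.src.shift p.μ, p.ν⟩
/-- Letter 3 of `∂p` (entering inverted): `⟨x + e_ν, μ⟩`. [folklore] -/
def bond₃ (p : Plaq P j) : PBond P j := ⟨p.src.shift p.ν, p.μ⟩
/-- Letter 4 of `∂p` (entering inverted): `⟨x, ν⟩`. [folklore] -/
def bond₄ (p : Plaq P j) : PBond P j := ⟨p.src, p.ν⟩

/-- Letters 1 and 2 differ (directions `μ ≠ ν`). [folklore] -/
theorem bond₁_ne_bond₂ (p : Plaq P j) : bond₁ p ≠ bond₂ p := by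
  simp only [bond₁, bond₂, ne_eq, PBond.mk.injEq, not_and]
  exact fun _ h => (ne_of_lt p.hμν) h

/-- Letters 1 and 3 differ (`x + e_ν ≠ x`). [folklore] -/
theorem bond₁_ne_bond₃ (p : Plaq P j) : bond₁ p ≠ bond₃ p := by
  simp only [bond₁, bond₃, ne_eq, PBond.mk.injEq, not_and]
  exact fun h _ => shift_ne_self p.src p.ν h.symm

/-- Letters 1 and 4 differ (directions). [folklore] -/
theorem bond₁_ne_bond₄ (p : Plaq P j) : bond₁ p ≠ bond₄ p := by
  simp only [bond₁, bond₄, ne_eq, PBond.mk.injEq, not_and]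
  exact fun _ h => (ne_of_lt p.hμν) h

/-- Letters 2 and 3 differ (directions). [folklore] -/
theorem bond₂_ne_bond₃ (p : Plaq P j) : bond₂ p ≠ bond₃ p := by
  simp only [bond₂, bond₃, ne_eq, PBond.mk.injEq, not_and]
  exact fun _ h => (ne_of_lt p.hμν) h.symm

/-- Letters 2 and 4 differ (`x + e_μ ≠ x`). [folklore] -/
theorem bond₂_ne_bond₄ (p : Plaq P j) : bond₂ p ≠ bond₄ p := by
  simp only [bond₂, bond₄, ne_eq, PBond.mk.injEq, not_and]
  exact fun h _ => shift_ne_self p.src p.μ h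

/-- Letters 3 and 4 differ (directions). [folklore] -/
theorem bond₃_ne_bond₄ (p : Plaq P j) : bond₃ p ≠ bond₄ p := by
  simp only [bond₃, bond₄, ne_eq, PBond.mk.injEq, not_and]
  exact fun _ h => (ne_of_lt p.hμν) h

/-- The four letters of `∂p` are pairwise distinct, on every torus of the cell. [folklore] -/
theorem letters_pairwise_ne (p : Plaq P j) : bond₁ p ≠ bond₂ p ∧ bond₁ p ≠ bond₃ p ∧ bond₁ p ≠ bond₄ p ∧
    bond₂ p ≠ bond₃ p ∧ bond₂ p ≠ bond₄ p ∧ bond₃ p ≠ bond₄ p :=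
  ⟨bond₁_ne_bond₂ p, bond₁_ne_bond₃ p, bond₁_ne_bond₄ p, bond₂_ne_bond₃ p, bond₂_ne_bond₄ p, bond₃_ne_bond₄ p⟩

/-- `b` is one of the four letters of `∂p` (reducible, so that it is decidable from `DecidableEq (PBond P j)` without
a dedicated instance). [folklore] -/
abbrev IsLetter (b : PBond P j) (p : Plaq P j) : Prop := b = bond₁ p ∨ b = bond₂ p ∨ b = bond₃ p ∨ b = bond₄ p

/-- `U(∂p)` spelled in the four letters. [folklore] -/
theorem plaqHol_eq_letters (U : GaugeField P j SU2) (p : Plaq P j) :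
    GaugeField.plaqHol U p = U (bond₁ p) * U (bond₂ p) * (U (bond₃ p))⁻¹ * (U (bond₄ p))⁻¹ := rfl

section Datum

variable [DecidableEq (PBond P j)]

/-- THE STAPLE DATUM of the plaquette `p` through the bond `b` at the base field `u`: the quaternion `a` with
`reTr U(∂p) = plaqKappa + Re(su2Quat U(b) · a)` when only `U(b)` moves — `su2Quat R · su2Quat L` for `b` in position 1
or 2 of `∂p = L·U(b)·R`, its conjugate for the inverted positions 3, 4, and `0` if `b ∉ ∂p`. [folklore] -/
def plaqDatum (u : GaugeField P j SU2) (b : PBond P j) (p : Plaq P j) : ℍ :=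
  if b = bond₁ p then su2Quat (u (bond₂ p) * (u (bond₃ p))⁻¹ * (u (bond₄ p))⁻¹)
  else if b = bond₂ p then su2Quat ((u (bond₃ p))⁻¹ * (u (bond₄ p))⁻¹) * su2Quat (u (bond₁ p))
  else if b = bond₃ p then star (su2Quat (u (bond₄ p))⁻¹ * su2Quat (u (bond₁ p) * u (bond₂ p)))
  else if b = bond₄ p then star (su2Quat (u (bond₁ p) * u (bond₂ p) * (u (bond₃ p))⁻¹))
  else 0

/-- The constant part: `0` if `b ∈ ∂p`, the frozen plaquette term `reTr u(∂p)` otherwise. [folklore] -/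
def plaqKappa (u : GaugeField P j SU2) (b : PBond P j) (p : Plaq P j) : ℝ :=
  if IsLetter b p then 0 else reTr (GaugeField.plaqHol u p)

/-- Off the plaquette the datum vanishes. [folklore] -/
theorem plaqDatum_of_not_isLetter {u : GaugeField P j SU2} {b : PBond P j} {p : Plaq P j} (h : ¬ IsLetter b p) :
    plaqDatum u b p = 0 := by
  simp only [IsLetter, not_or] at h
  simp only [plaqDatum, if_neg h.1, if_neg h.2.1, if_neg h.2.2.1, if_neg h.2.2.2]

/-- **EVERY PLAQUETTE TERM IS ONE-LINK QUATERNION-AFFINE THROUGH EVERY BOND**, with the staple datum: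
`reTr (u with u(b) := g)(∂p) = plaqKappa u b p + Re(su2Quat g · plaqDatum u b p)` for all `g ∈ SU(2)`. [folklore] -/
theorem linkAffine_reTr_plaqHol (u : GaugeField P j SU2) (b : PBond P j) (p : Plaq P j) :
    LinkAffine (fun U => reTr (GaugeField.plaqHol U p)) u b (plaqKappa u b p) (plaqDatum u b p) := by
  intro g
  dsimp only
  rw [plaqHol_eq_letters]
  by_cases h1 : b = bond₁ p
  · subst h1
    rw [Function.update_self, Function.update_of_ne (bond₁_ne_bond₂ p).symm,
      Function.update_of_ne (bond₁_ne_bond₃ p).symm, Function.update_of_ne (bond₁_ne_bond₄ p).symm, plaqDatum,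
      if_pos rfl, plaqKappa, if_pos (show IsLetter (bond₁ p) p from Or.inl rfl),
      show g * u (bond₂ p) * (u (bond₃ p))⁻¹ * (u (bond₄ p))⁻¹ =
          1 * g * (u (bond₂ p) * (u (bond₃ p))⁻¹ * (u (bond₄ p))⁻¹) by simp only [one_mul, mul_assoc],
      reTr_conj_link, su2Quat_one, mul_one, zero_add]
  by_cases h2 : b = bond₂ p
  · subst h2
    rw [Function.update_self, Function.update_of_ne (bond₁_ne_bond₂ p),
      Function.update_of_ne (bond₂_ne_bond₃ p).symm, Function.update_of_ne (bond₂_ne_bond₄ p).symm, plaqDatum,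
      if_neg h1, if_pos rfl, plaqKappa, if_pos (show IsLetter (bond₂ p) p from Or.inr (Or.inl rfl)),
      mul_assoc (u (bond₁ p) * g),
      reTr_conj_link, zero_add]
  by_cases h3 : b = bond₃ p
  · subst h3
    rw [Function.update_self, Function.update_of_ne (bond₁_ne_bond₃ p), Function.update_of_ne (bond₂_ne_bond₃ p),
      Function.update_of_ne (bond₃_ne_bond₄ p).symm, plaqDatum, if_neg h1, if_neg h2, if_pos rfl, plaqKappa,
      if_pos (show IsLetter (bond₃ p) p from Or.inr (Or.inr (Or.inl rfl))), reTr_conj_link, su2Quat_inv g, re_star_mul,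
      su2Quat_mul, zero_add]
  by_cases h4 : b = bond₄ p
  · subst h4
    rw [Function.update_self, Function.update_of_ne (bond₁_ne_bond₄ p), Function.update_of_ne (bond₂_ne_bond₄ p),
      Function.update_of_ne (bond₃_ne_bond₄ p), plaqDatum, if_neg h1, if_neg h2, if_neg h3, if_pos rfl, plaqKappa,
      if_pos (show IsLetter (bond₄ p) p from Or.inr (Or.inr (Or.inr rfl))),
      ← mul_one (u (bond₁ p) * u (bond₂ p) * (u (bond₃ p))⁻¹ * g⁻¹),
      reTr_conj_link, su2Quat_one, one_mul, su2Quat_inv g, re_star_mul, zero_add]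
  · have hn : ¬ IsLetter b p := by simp only [IsLetter, not_or]; exact ⟨h1, h2, h3, h4⟩
    rw [Function.update_of_ne (Ne.symm h1), Function.update_of_ne (Ne.symm h2), Function.update_of_ne (Ne.symm h3),
      Function.update_of_ne (Ne.symm h4), plaqDatum_of_not_isLetter hn, plaqKappa, if_neg hn, mul_zero,
      Quaternion.re_zero, add_zero, plaqHol_eq_letters]

/-- Change of data along equal numbers. [folklore] -/
theorem linkAffine_congr_data {h : Density P j SU2} {u : GaugeField P j SU2} {b : PBond P j} {κ κ' : ℝ} {a a' : ℍ}
    (H : LinkAffine h u b κ a) (hκ : κ = κ') (ha : a = a') : LinkAffine h u b κ' a' := by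
  subst hκ ha
  exact H

/-! ## §4  The Wilson action is one-link quaternion-affine through every bond -/

/-- Constant part of `c · A_W` along the link `b` at `u`. [folklore] -/
def wilsonKappa (c w : ℝ) (u : GaugeField P j SU2) (b : PBond P j) : ℝ :=
  ∑ p : Plaq P j, c * w * (1 - plaqKappa u b p)

/-- THE WILSON DATUM through `b` at `u`: `−c·w` times the staple sum `Σ_p plaqDatum u b p`. [folklore] -/
def wilsonDatum (c w : ℝ) (u : GaugeField P j SU2) (b : PBond P j) : ℍ :=
  ∑ p : Plaq P j, (-(c * w)) • plaqDatum u b p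

/-- One weighted plaquette term `c·w·(1 − reTr U(∂p))`. [folklore] -/
theorem linkAffine_plaqTerm (c w : ℝ) (u : GaugeField P j SU2) (b : PBond P j) (p : Plaq P j) :
    LinkAffine (fun U => c * (w * (1 - reTr (GaugeField.plaqHol U p)))) u b (c * w * (1 - plaqKappa u b p))
      ((-(c * w)) • plaqDatum u b p) := by
  have H := linkAffine_add (linkAffine_const (u := u) (b := b) (c * w))
    (linkAffine_smul (linkAffine_reTr_plaqHol u b p) (-(c * w)))
  refine linkAffine_congr_data (linkAffine_congr H fun U => ?_) (by ring) (by rw [zero_add])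
  ring

/-- **THE WILSON ACTION IS ONE-LINK QUATERNION-AFFINE THROUGH EVERY BOND** (caveat (PLAQ) of
`T4GnomonicWilsonHessian` discharged): for every real `c`, weight `w`, base field `u` and bond `b` of every torus
`T^{(j)}` of the cell, `U ↦ c · wilsonAction w U` satisfies
`LinkAffine _ u b (wilsonKappa c w u b) (wilsonDatum c w u b)`.  For the Gibbs exponent `h = −β·A_W` take `c = −β`.
[folklore] -/
theorem linkAffine_wilsonAction (c w : ℝ) (u : GaugeField P j SU2) (b : PBond P j) :
    LinkAffine (fun U => c * wilsonAction w U) u b (wilsonKappa c w u b) (wilsonDatum c w u b) := by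
  have H := linkAffine_sum (u := u) (b := b) (Finset.univ : Finset (Plaq P j))
    (fun p _ => linkAffine_plaqTerm c w u b p)
  exact linkAffine_congr H fun U => by simp only [wilsonAction, Finset.mul_sum]

/-- … and the same with any added `U(b)`-independent term `r` (boundary terms, frozen factors). [folklore] -/
theorem linkAffine_wilsonAction_add_indep (c w : ℝ) (u : GaugeField P j SU2) (b : PBond P j) {r : Density P j SU2}
    (hr : ∀ g : SU2, r (Function.update u b g) = r u) :
    LinkAffine (fun U => c * wilsonAction w U + r U) u b (wilsonKappa c w u b + r u) (wilsonDatum c w u b) :=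
  linkAffine_add_indep (linkAffine_wilsonAction c w u b) hr

/-! ## §5  The trivial configuration: an aligned datum counting the plaquettes through `b` -/

/-- At `u = 1` the staple of every plaquette through `b` is `1`. [folklore] -/
theorem plaqDatum_one (b : PBond P j) (p : Plaq P j) :
    plaqDatum (1 : GaugeField P j SU2) b p = if IsLetter b p then 1 else 0 := by
  have h1 : ∀ b' : PBond P j, (1 : GaugeField P j SU2) b' = 1 := fun _ => rfl
  by_cases hL : IsLetter b p
  · rw [if_pos hL]
    simp only [plaqDatum, h1, inv_one, mul_one, su2Quat_one, star_one]
    rcases hL with h | h | h | h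
    · rw [if_pos h]
    · by_cases h1' : b = bond₁ p
      · rw [if_pos h1']
      · rw [if_neg h1', if_pos h]
    · by_cases h1' : b = bond₁ p
      · rw [if_pos h1']
      · by_cases h2' : b = bond₂ p
        · rw [if_neg h1', if_pos h2']
        · rw [if_neg h1', if_neg h2', if_pos h]
    · by_cases h1' : b = bond₁ p
      · rw [if_pos h1']
      · by_cases h2' : b = bond₂ p
        · rw [if_neg h1', if_pos h2']
        · by_cases h3' : b = bond₃ p
          · rw [if_neg h1', if_neg h2', if_pos h3']
          · rw [if_neg h1', if_neg h2', if_neg h3', if_pos h]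
  · rw [if_neg hL, plaqDatum_of_not_isLetter hL]

/-- `N_b = #{p : b ∈ ∂p}`, the number of plaquettes through the bond `b`. [folklore] -/
def letterCount (b : PBond P j) : ℕ := (Finset.univ.filter (fun p : Plaq P j => IsLetter b p)).card

/-- Hence the Wilson datum at `u = 1` is the REAL quaternion `−c·w·N_b`, `N_b = #{p : b ∈ ∂p}`: aligned with
`q₀ = su2Quat 1 = 1`, zero transverse part. [folklore] -/
theorem wilsonDatum_one (c w : ℝ) (b : PBond P j) :
    wilsonDatum c w (1 : GaugeField P j SU2) b =
      ((-(c * w) * (letterCount b : ℝ) : ℝ) : ℍ) := by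
  have h : wilsonDatum c w (1 : GaugeField P j SU2) b = (-(c * w)) • ((letterCount b : ℕ) : ℍ) := by
    simp only [wilsonDatum, plaqDatum_one, ← Finset.smul_sum, Finset.sum_boole, letterCount]
  rw [h, ← Quaternion.coe_natCast (letterCount b), Quaternion.smul_coe]

/-- … so the parent's aligned number `A = Re(a · q₀)` at `u₀ = 1` is `−c·w·N_b` and the transverse bound may be taken
`b₀ = 0` (`‖a‖² − A² = 0`). [folklore] -/
theorem wilsonDatum_one_aligned (c w : ℝ) (b : PBond P j) :
    (wilsonDatum c w (1 : GaugeField P j SU2) b * su2Quat ((1 : GaugeField P j SU2) b)).re =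
        -(c * w) * (letterCount b : ℝ) ∧
      ‖wilsonDatum c w (1 : GaugeField P j SU2) b‖ ^ 2 -
        (wilsonDatum c w (1 : GaugeField P j SU2) b * su2Quat ((1 : GaugeField P j SU2) b)).re ^ 2 = 0 := by
  have h1 : (1 : GaugeField P j SU2) b = 1 := rfl
  rw [h1, su2Quat_one, mul_one, wilsonDatum_one, Quaternion.re_coe, Quaternion.norm_coe, Real.norm_eq_abs, sq_abs,
    sub_self]
  exact ⟨rfl, rfl⟩

end Datum

/-! ## §5b  The plaquette count through a bond: `N_b = 2(d − 1)` (uses the tree's `Site.shift_unshift`,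
`Site.unshift_shift` of `T4Covariance`) -/

section Count

variable [DecidableEq (PBond P j)]

/-- Plaquettes with `b` in position 1 ↔ directions `ν > μ` (`p = (x, μ, ν)`). [folklore] -/
theorem card_filter_bond₁ (b : PBond P j) :
    (Finset.univ.filter fun p : Plaq P j => b = bond₁ p).card = (Finset.Ioi b.dir).card := by
  refine Finset.card_bij' (fun p _ => p.ν) (fun ν hν => ⟨b.src, b.dir, ν, Finset.mem_Ioi.1 hν⟩) ?_ ?_ ?_ ?_
  · intro p hp
    simp only [Finset.mem_filter, Finset.mem_univ, true_and] at hp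
    subst hp
    exact Finset.mem_Ioi.2 p.hμν
  · intro ν hν
    simp only [Finset.mem_filter, Finset.mem_univ, true_and, bond₁]
  · intro p hp
    simp only [Finset.mem_filter, Finset.mem_univ, true_and] at hp
    subst hp
    rfl
  · intro ν hν
    rfl

/-- Plaquettes with `b` in position 4 ↔ directions `ν < μ` (`p = (x, ν, μ)`). [folklore] -/
theorem card_filter_bond₄ (b : PBond P j) :
    (Finset.univ.filter fun p : Plaq P j => b = bond₄ p).card = (Finset.Iio b.dir).card := by
  refine Finset.card_bij' (fun p _ => p.μ) (fun ν hν => ⟨b.src, ν, b.dir, Finset.mem_Iio.1 hν⟩) ?_ ?_ ?_ ?_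
  · intro p hp
    simp only [Finset.mem_filter, Finset.mem_univ, true_and] at hp
    subst hp
    exact Finset.mem_Iio.2 p.hμν
  · intro ν hν
    simp only [Finset.mem_filter, Finset.mem_univ, true_and, bond₄]
  · intro p hp
    simp only [Finset.mem_filter, Finset.mem_univ, true_and] at hp
    subst hp
    rfl
  · intro ν hν
    rfl

/-- Plaquettes with `b` in position 3 ↔ directions `ν > μ` (`p = (x − e_ν, μ, ν)`). [folklore] -/
theorem card_filter_bond₃ (b : PBond P j) :
    (Finset.univ.filter fun p : Plaq P j => b = bond₃ p).card = (Finset.Ioi b.dir).card := by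
  refine Finset.card_bij' (fun p _ => p.ν) (fun ν hν => ⟨b.src.unshift ν, b.dir, ν, Finset.mem_Ioi.1 hν⟩)
    ?_ ?_ ?_ ?_
  · intro p hp
    simp only [Finset.mem_filter, Finset.mem_univ, true_and] at hp
    subst hp
    exact Finset.mem_Ioi.2 p.hμν
  · intro ν hν
    simp only [Finset.mem_filter, Finset.mem_univ, true_and, bond₃, Site.shift_unshift]
  · intro p hp
    simp only [Finset.mem_filter, Finset.mem_univ, true_and] at hp
    subst hp
    simp only [bond₃, Site.unshift_shift]
  · intro ν hν
    rfl

/-- Plaquettes with `b` in position 2 ↔ directions `ν < μ` (`p = (x − e_ν, ν, μ)`). [folklore] -/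
theorem card_filter_bond₂ (b : PBond P j) :
    (Finset.univ.filter fun p : Plaq P j => b = bond₂ p).card = (Finset.Iio b.dir).card := by
  refine Finset.card_bij' (fun p _ => p.μ) (fun ν hν => ⟨b.src.unshift ν, ν, b.dir, Finset.mem_Iio.1 hν⟩)
    ?_ ?_ ?_ ?_
  · intro p hp
    simp only [Finset.mem_filter, Finset.mem_univ, true_and] at hp
    subst hp
    exact Finset.mem_Iio.2 p.hμν
  · intro ν hν
    simp only [Finset.mem_filter, Finset.mem_univ, true_and, bond₂, Site.shift_unshift]
  · intro p hp
    simp only [Finset.mem_filter, Finset.mem_univ, true_and] at hp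
    subst hp
    simp only [bond₂, Site.unshift_shift]
  · intro ν hν
    rfl

/-- The four letter events are mutually exclusive (`letters_pairwise_ne`), so `N_b` is the sum of the four position
counts. [folklore] -/
theorem letterCount_eq_add (b : PBond P j) :
    letterCount b = (Finset.univ.filter fun p : Plaq P j => b = bond₁ p).card +
      ((Finset.univ.filter fun p : Plaq P j => b = bond₂ p).card +
      ((Finset.univ.filter fun p : Plaq P j => b = bond₃ p).card +
        (Finset.univ.filter fun p : Plaq P j => b = bond₄ p).card)) := by
  classical
  have d12 : Disjoint (Finset.univ.filter fun p : Plaq P j => b = bond₁ p)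
      (Finset.univ.filter fun p : Plaq P j => b = bond₂ p) :=
    Finset.disjoint_filter.2 fun p _ h h' => bond₁_ne_bond₂ p (h.symm.trans h')
  have d13 : Disjoint (Finset.univ.filter fun p : Plaq P j => b = bond₁ p)
      (Finset.univ.filter fun p : Plaq P j => b = bond₃ p) :=
    Finset.disjoint_filter.2 fun p _ h h' => bond₁_ne_bond₃ p (h.symm.trans h')
  have d14 : Disjoint (Finset.univ.filter fun p : Plaq P j => b = bond₁ p)
      (Finset.univ.filter fun p : Plaq P j => b = bond₄ p) :=
    Finset.disjoint_filter.2 fun p _ h h' => bond₁_ne_bond₄ p (h.symm.trans h')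
  have d23 : Disjoint (Finset.univ.filter fun p : Plaq P j => b = bond₂ p)
      (Finset.univ.filter fun p : Plaq P j => b = bond₃ p) :=
    Finset.disjoint_filter.2 fun p _ h h' => bond₂_ne_bond₃ p (h.symm.trans h')
  have d24 : Disjoint (Finset.univ.filter fun p : Plaq P j => b = bond₂ p)
      (Finset.univ.filter fun p : Plaq P j => b = bond₄ p) :=
    Finset.disjoint_filter.2 fun p _ h h' => bond₂_ne_bond₄ p (h.symm.trans h')
  have d34 : Disjoint (Finset.univ.filter fun p : Plaq P j => b = bond₃ p)
      (Finset.univ.filter fun p : Plaq P j => b = bond₄ p) :=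
    Finset.disjoint_filter.2 fun p _ h h' => bond₃_ne_bond₄ p (h.symm.trans h')
  have e : (Finset.univ.filter fun p : Plaq P j => IsLetter b p) =
      (Finset.univ.filter fun p : Plaq P j => b = bond₁ p) ∪
        ((Finset.univ.filter fun p : Plaq P j => b = bond₂ p) ∪
          ((Finset.univ.filter fun p : Plaq P j => b = bond₃ p) ∪
            (Finset.univ.filter fun p : Plaq P j => b = bond₄ p))) := by
    ext p
    simp only [Finset.mem_filter, Finset.mem_union, Finset.mem_univ, true_and, IsLetter]
  rw [letterCount, e,
    Finset.card_union_of_disjoint (Finset.disjoint_union_right.2 ⟨d12, Finset.disjoint_union_right.2 ⟨d13, d14⟩⟩),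
    Finset.card_union_of_disjoint (Finset.disjoint_union_right.2 ⟨d23, d24⟩), Finset.card_union_of_disjoint d34]

/-- **`N_b = 2(d − 1)`**: every bond of every torus of the cell lies in exactly `2(d − 1)` plaquettes. [folklore] -/
theorem letterCount_eq (b : PBond P j) : letterCount b = 2 * (P.d - 1) := by
  rw [letterCount_eq_add, card_filter_bond₁, card_filter_bond₂, card_filter_bond₃, card_filter_bond₄, Fin.card_Ioi,
    Fin.card_Iio]
  have := b.dir.isLt
  omega

/-- Hence at `u₀ = 1` the aligned number of the Wilson exponent `c·A_W` through any bond is `A = −2(d−1)·c·w`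
(`= 2(d−1)βw > 0` for `c = −β < 0`, `w > 0`, `d ≥ 2`). [folklore] -/
theorem wilsonDatum_one_re (c w : ℝ) (b : PBond P j) :
    (wilsonDatum c w (1 : GaugeField P j SU2) b * su2Quat ((1 : GaugeField P j SU2) b)).re =
      -(c * w) * (2 * ((P.d : ℝ) - 1)) := by
  rw [(wilsonDatum_one_aligned c w b).1, letterCount_eq, Nat.cast_mul, Nat.cast_ofNat]
  have hd := P.hd
  rw [Nat.cast_sub hd, Nat.cast_one]

/-- Non-vacuity of the parent's aligned-sign binder `hA₀ : 0 ≤ Re(a₀ · q₀)` at the flat base field `u₀ = 1` for the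
Gibbs exponent `−β·A_W` (`c = −β`), `β, w ≥ 0`. [folklore] -/
example {β w : ℝ} (hβ : 0 ≤ β) (hw : 0 ≤ w) (b : PBond P j) :
    0 ≤ (wilsonDatum (-β) w (1 : GaugeField P j SU2) b * su2Quat ((1 : GaugeField P j SU2) b)).re := by
  rw [wilsonDatum_one_re]
  have hd : (1 : ℝ) ≤ P.d := by exact_mod_cast P.hd
  have h2 : (0 : ℝ) ≤ 2 * ((P.d : ℝ) - 1) := by linarith
  have h3 : -(-β * w) = β * w := by ring
  rw [h3]
  exact mul_nonneg (mul_nonneg hβ hw) h2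

end Count


end Literature.MathematicalPhysics.QuantumFieldTheory.Balaban1983to89.T4WilsonLinkAffine
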